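import Summits.KontsevichZagierPeriods.KontsevichZagierPeriods.Theorems.RootDecompRelativeModAbsoluteCylLogSplitP28

/-! # `RootDecompRelativeModAbsoluteCylLogSplitP29` — part 4/27 of the mechanical ≤400-line split of `RungClosure.lean` (sha256 f909f334226f0fb5…)
Source: decomp-kz lens-3 g12 `RungClosure.lean` v9 (HOME/decomp-kz-lens-3/g12/, sha256 f909f334…; critic g4-52/g4-57/g5 CLEARED, «lander: split v9 --supports 30572»): BLOCK I (57 g11 monolith decls missing from P01–P25), BLOCK II/III (WildCertAssembly parts 1–6, 8–10: `Leaf.cellLocalWildCert`, `Leaf.cylKernelZeroLog_of_trees`), Parts 12–13 (`Leaf.regKernelPairDegOne_iff_circlePos_of_trees`), BLOCK G13 (Möbius engine, test §C decided).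
Split by census-1 g9 `gen/splitlean.py`: scopes re-opened with their `open`/`variable`/`set_option` context; mathematics and declaration order unchanged. -/

noncomputable section
open Set MeasureTheory Filter Topology
open scoped BigOperators
open Literature.NumberTheory.Transcendental Literature.ModelTheory.ExponentialFields
namespace Summit.KontsevichZagierPeriods.RootDecompRelativeModAbsolute.Rung30571
namespace RegularisedLogLayer
namespace CylLog
variable {b : ℕ}

open scoped ContDiff in
/-- **`CellCloseLSTame`** — `CellCloseLS` restricted to TAME cells (`TameCell`).  [PROVED from `BoundaryRigidity` BY NAME:
`cellCloseLSTame_of_boundaryRigidity` (§3ag `cellCloseLS_tame` = D1 split · D4± · folds · log identity · `tameClose`)] -/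
def CellCloseLSTame : Prop :=
  ∀ (E : Set (Fin 1 → ℝ)) (V : KZ.IntegralRep (1 + 1)) (a₀ : (Fin 1 → ℝ) → ℝ) (q : ℕ)
    (c κ : Fin q → (Fin 1 → ℝ) → ℝ) (M : Fin q → ℕ) (σ : Fin q → Fin 3)
    (R : ℕ) (f : Fin R → Fin q → ℤ) (qq : Fin R → (Fin 1 → ℝ) → ℝ),
    IsOpen E → IsSemialgebraic ℚ E →
    IsSemialgebraicFunOn ℚ E a₀ → ContDiffOn ℝ ∞ a₀ E → IntegrableOn a₀ E →
    (∀ i, IsSemialgebraicFunOn ℚ E (c i)) → (∀ i, ContDiffOn ℝ ∞ (c i) E) →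
    (∀ i, IsSemialgebraicFunOn ℚ E (κ i)) → (∀ i, ContDiffOn ℝ ∞ (κ i) E) →
    (∀ i, ∀ x ∈ E, -1 < κ i x) →
    (∀ i, σ i = 0 → ∀ x ∈ E, 0 < κ i x) → (∀ i, σ i = 1 → ∀ x ∈ E, κ i x < 0) →
    (∀ i, σ i = 2 → ∀ x ∈ E, κ i x = 0) →
    (∀ i, IntegrableOn (fun z : Fin (1 + 1) → ℝ =>
      c i (Fin.init z) * (z (Fin.last 1) ^ M i / (1 + z (Fin.last 1) * κ i (Fin.init z))))
      {z : Fin (1 + 1) → ℝ | (Fin.init z : Fin 1 → ℝ) ∈ E ∧ z (Fin.last 1) ∈ Set.Ioo 0 1}) →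
    (∀ i, IntegrableOn (fun x => c i x * ∫ θ in Set.Ioo (0 : ℝ) 1, θ ^ M i / (1 + θ * κ i x)) E) →
    V.domain = {z : Fin (1 + 1) → ℝ | (Fin.init z : Fin 1 → ℝ) ∈ E ∧ z (Fin.last 1) ∈ Set.Ioo 0 1} →
    Set.EqOn V.integrand (fun z => a₀ (Fin.init z) +
      ∑ i, c i (Fin.init z) * (z (Fin.last 1) ^ M i / (1 + z (Fin.last 1) * κ i (Fin.init z))))
      V.domain →
    (∀ x ∈ E, a₀ x + ∑ i, polyPart (sgnB σ) c κ M i x = 0) →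
    (∀ r, IsSemialgebraicFunOn ℚ E (qq r)) →
    (∀ r, ∀ x ∈ E, ∏ i, (1 + κ i x) ^ (f r i) = 1) →
    (∀ i, ∀ x ∈ E, logCoef (sgnB σ) c κ M i x = ∑ r, qq r x * (f r i : ℝ)) →
    TameCell E c κ M σ → KZ.of V ∈ KZ.relations

open scoped ContDiff in
/-- **`CellCloseLSWild`** — `CellCloseLS` restricted to WILD (non-tame) cells: an index with `κᵢ → 0` at an end of `E`,
`Mᵢ ≥ 1` and `cᵢ/κᵢ^{Mᵢ} ∉ L¹` there.  This is ALL that is left of the log kind `CylKernelZeroLog` after g11.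
[UNDECIDED · ATTACKABLE-NOW · blueprint NODE-g10 Addenda J–L: RAISE the order at the degenerate `κ→0` ends
(`regOrder_telescope` upward), split the coefficients along the exact relation lattice (`hcoef`/`hprod`), close the
split families by `RegTorusProductBands` (§3w `regCells_mem_relations_of_zpow_rel`); the cross-term obstruction of
Addendum L is the crux] -/
def CellCloseLSWild : Prop :=
  ∀ (E : Set (Fin 1 → ℝ)) (V : KZ.IntegralRep (1 + 1)) (a₀ : (Fin 1 → ℝ) → ℝ) (q : ℕ)
    (c κ : Fin q → (Fin 1 → ℝ) → ℝ) (M : Fin q → ℕ) (σ : Fin q → Fin 3)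
    (R : ℕ) (f : Fin R → Fin q → ℤ) (qq : Fin R → (Fin 1 → ℝ) → ℝ),
    IsOpen E → IsSemialgebraic ℚ E →
    IsSemialgebraicFunOn ℚ E a₀ → ContDiffOn ℝ ∞ a₀ E → IntegrableOn a₀ E →
    (∀ i, IsSemialgebraicFunOn ℚ E (c i)) → (∀ i, ContDiffOn ℝ ∞ (c i) E) →
    (∀ i, IsSemialgebraicFunOn ℚ E (κ i)) → (∀ i, ContDiffOn ℝ ∞ (κ i) E) →
    (∀ i, ∀ x ∈ E, -1 < κ i x) →
    (∀ i, σ i = 0 → ∀ x ∈ E, 0 < κ i x) → (∀ i, σ i = 1 → ∀ x ∈ E, κ i x < 0) →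
    (∀ i, σ i = 2 → ∀ x ∈ E, κ i x = 0) →
    (∀ i, IntegrableOn (fun z : Fin (1 + 1) → ℝ =>
      c i (Fin.init z) * (z (Fin.last 1) ^ M i / (1 + z (Fin.last 1) * κ i (Fin.init z))))
      {z : Fin (1 + 1) → ℝ | (Fin.init z : Fin 1 → ℝ) ∈ E ∧ z (Fin.last 1) ∈ Set.Ioo 0 1}) →
    (∀ i, IntegrableOn (fun x => c i x * ∫ θ in Set.Ioo (0 : ℝ) 1, θ ^ M i / (1 + θ * κ i x)) E) →
    V.domain = {z : Fin (1 + 1) → ℝ | (Fin.init z : Fin 1 → ℝ) ∈ E ∧ z (Fin.last 1) ∈ Set.Ioo 0 1} →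
    Set.EqOn V.integrand (fun z => a₀ (Fin.init z) +
      ∑ i, c i (Fin.init z) * (z (Fin.last 1) ^ M i / (1 + z (Fin.last 1) * κ i (Fin.init z))))
      V.domain →
    (∀ x ∈ E, a₀ x + ∑ i, polyPart (sgnB σ) c κ M i x = 0) →
    (∀ r, IsSemialgebraicFunOn ℚ E (qq r)) →
    (∀ r, ∀ x ∈ E, ∏ i, (1 + κ i x) ^ (f r i) = 1) →
    (∀ i, ∀ x ∈ E, logCoef (sgnB σ) c κ M i x = ∑ r, qq r x * (f r i : ℝ)) →
    ¬ TameCell E c κ M σ → KZ.of V ∈ KZ.relations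

/-- **The split is exact (PROVED): `CellCloseLS ⟺ CellCloseLSTame ∧ CellCloseLSWild`.** -/
theorem cellCloseLS_iff_tame_and_wild : CellCloseLS ↔ (CellCloseLSTame ∧ CellCloseLSWild) := by
  constructor
  · intro h
    exact ⟨fun E V a₀ q c κ M σ R f qq hEo hE ha₀ ha_sm ha₀i hc hc_sm hκ hκ_sm hκ1 hσ0 hσ1 hσ2 hint hL1 hdom hV hpoly hqq hprod hcoef _ =>
        h E V a₀ q c κ M σ R f qq hEo hE ha₀ ha_sm ha₀i hc hc_sm hκ hκ_sm hκ1 hσ0 hσ1 hσ2 hint hL1 hdom hV hpoly hqq hprod hcoef,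
      fun E V a₀ q c κ M σ R f qq hEo hE ha₀ ha_sm ha₀i hc hc_sm hκ hκ_sm hκ1 hσ0 hσ1 hσ2 hint hL1 hdom hV hpoly hqq hprod hcoef _ =>
        h E V a₀ q c κ M σ R f qq hEo hE ha₀ ha_sm ha₀i hc hc_sm hκ hκ_sm hκ1 hσ0 hσ1 hσ2 hint hL1 hdom hV hpoly hqq hprod hcoef⟩
  · rintro ⟨hT, hW⟩ E V a₀ q c κ M σ R f qq hEo hE ha₀ ha_sm ha₀i hc hc_sm hκ hκ_sm hκ1 hσ0 hσ1 hσ2 hint hL1 hdom hV hpoly hqq hprod hcoef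
    by_cases ht : TameCell E c κ M σ
    · exact hT E V a₀ q c κ M σ R f qq hEo hE ha₀ ha_sm ha₀i hc hc_sm hκ hκ_sm hκ1 hσ0 hσ1 hσ2 hint hL1 hdom hV hpoly hqq hprod hcoef ht
    · exact hW E V a₀ q c κ M σ R f qq hEo hE ha₀ ha_sm ha₀i hc hc_sm hκ hκ_sm hκ1 hσ0 hσ1 hσ2 hint hL1 hdom hV hpoly hqq hprod hcoef ht

/-- **`BoundaryRigidity → CellCloseLSTame` (PROVED, §3ag).** -/
theorem cellCloseLSTame_of_boundaryRigidity
    (hBR : Summit.KontsevichZagierPeriods.LiouvilleUnfolding.LogPrimitiveNL.Negative.BoundaryRigidity) :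
    CellCloseLSTame :=
  fun E V a₀ q c κ M σ R f qq hEo hE ha₀ ha_sm ha₀i hc hc_sm hκ hκ_sm hκ1 hσ0 hσ1 hσ2 hint hL1 hdom hV hpoly hqq hprod hcoef ht =>
    cellCloseLS_tame hBR E V a₀ q c κ M σ R f qq hEo hE ha₀ ha_sm ha₀i hc hc_sm hκ hκ_sm hκ1 hσ0 hσ1 hσ2 hint hL1 hdom hV hpoly hqq hprod hcoef ht.1 ht.2

/-- **The glue spine of the log kind after g11 (PROVED):
`LogStructure → BoundaryRigidity → CellCloseLSWild → CylKernelZeroLog`.** -/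
theorem cylKernelZeroLog_of_wild (hLS : LogStructure)
    (hBR : Summit.KontsevichZagierPeriods.LiouvilleUnfolding.LogPrimitiveNL.Negative.BoundaryRigidity)
    (hW : CellCloseLSWild) : CylKernelZeroLog :=
  cylKernelZeroLog_of_cellCloseLS hLS
    (cellCloseLS_iff_tame_and_wild.2 ⟨cellCloseLSTame_of_boundaryRigidity hBR, hW⟩)

/-- **… and the whole degree-one statement (PROVED glue): `LogStructure → BoundaryRigidity → CellCloseLSWild →
CylKernelZeroMixed → CylKernelZero`.** -/
theorem cylKernelZero_of_wild_and_mixed (hLS : LogStructure)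
    (hBR : Summit.KontsevichZagierPeriods.LiouvilleUnfolding.LogPrimitiveNL.Negative.BoundaryRigidity)
    (hW : CellCloseLSWild) (hM : CylKernelZeroMixed) : CylKernelZero :=
  cylKernelZero_of_log_and_mixed (cylKernelZeroLog_of_wild hLS hBR hW) hM

/-! ### §3ai The WILD closing engine `wildClose` (g11)

The twin of `tameClose` for cells whose pure-log coefficients are NOT integrable (the wild class of
§3ah): raise the `Z`-cells to a common order `m` (`regOrder_telescope`, honest because it only costs
`d_i (W_i − 1)^{j+1} ∈ L¹`), split ONLY the raised `Z`-coefficients along exact multiplicative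
relations supported on `Z` (`(−1)^{M_i} d_i = Σ_r qq_r g_{ri} + Ñ_i`), close each pure-`Z` family by
the torus lemma `regCells_mem_relations_of_zpow_rel`, and hand the mixed family (coefficients `Ñ`,
orders `m` on `Z`, `M_i` off `Z`) to `tameClose`.  The conclusion is IDENTICAL to `tameClose`'s, so the
`CellCloseLS`-level wrapper of §3ag applies verbatim once its hypotheses are produced (g12). -/

/-- Order telescope for `polyLog`: raising from order `M` to order `m ≥ M`. -/
theorem polyLog_telescope {M m : ℕ} (hMm : M ≤ m) (w : ℝ) :
    polyLog M w = (-1:ℝ) ^ (m - M) * polyLog m w +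
      ∑ j ∈ Finset.Ico M m, (-1:ℝ) ^ (j - M) * ((w - 1) ^ (j + 1) / (j + 1)) := by
  induction m, hMm using Nat.le_induction with
  | base => simp
  | succ m hMm ih =>
    rw [ih, Finset.sum_Ico_succ_top hMm, polyLog_succ, Nat.sub_add_comm hMm,
      show (-1:ℝ) ^ (m - M + 1) = (-1) ^ (m - M) * (-1) from pow_succ _ _]
    ring

/-- The padded edge functions: `W_i` on `Z`, the constant `1` off `Z`. -/
def zW {b k : ℕ} (Z : Fin k → Bool) (W : Fin k → (Fin b → ℝ) → ℝ) (i : Fin k) : (Fin b → ℝ) → ℝ :=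
  if Z i then W i else fun _ => 1

/-- Auxiliary step `zW_of_true` (§3ai): z W of true. [bookkeeping] -/
theorem zW_of_true {b k : ℕ} {Z : Fin k → Bool} {W : Fin k → (Fin b → ℝ) → ℝ} {i : Fin k}
    (h : Z i = true) : zW Z W i = W i := by simp [zW, h]

/-- Auxiliary step `zW_of_false` (§3ai): z W of false. [bookkeeping] -/
theorem zW_of_false {b k : ℕ} {Z : Fin k → Bool} {W : Fin k → (Fin b → ℝ) → ℝ} {i : Fin k}
    (h : Z i = false) : zW Z W i = fun _ => 1 := by simp [zW, h]

/-- A representation over the NULL band `G × [1, 1]` with a prescribed regularised integrand (the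
padding cells of the non-`Z` indices in the torus step: they carry coefficient `0` in every relation). -/
theorem exists_nullBandRep {b : ℕ} (m : ℕ) {G : Set (Fin b → ℝ)} (hG : IsSemialgebraic ℚ G)
    {q : (Fin b → ℝ) → ℝ} (hq : IsSemialgebraicFunOn ℚ G q) :
    ∃ R : KZ.IntegralRep (b + 1), R.domain = KZlog.band G (fun _ => 1) (fun _ => 1) ∧
      R.integrand = fun z => q (Fin.init z) * ((z (Fin.last b) - 1) ^ m / z (Fin.last b)) := by
  have h1sa : IsSemialgebraicFunOn ℚ G (fun _ => (1:ℝ)) :=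
    (isSemialgebraicFunOn_ratCast hG 1).congr fun _ _ => by simp
  have hbsa : IsSemialgebraic ℚ (KZlog.band G (fun _ => (1:ℝ)) (fun _ => 1)) :=
    KZlog.isSemialgebraic_band h1sa h1sa
  have hband_sub : KZlog.band G (fun _ => (1:ℝ)) (fun _ => 1) ⊆ {z : Fin (b + 1) → ℝ | Fin.init z ∈ G} :=
    fun z hz => hz.1
  have hqI : IsSemialgebraicFunOn ℚ (KZlog.band G (fun _ => (1:ℝ)) (fun _ => 1)) (fun z => q (Fin.init z)) :=
    hq.comp_init.mono hband_sub hbsa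
  have hsI : IsSemialgebraicFunOn ℚ (KZlog.band G (fun _ => (1:ℝ)) (fun _ => 1)) (fun z => z (Fin.last b)) :=
    Literature.NumberTheory.Transcendental.isSemialgebraicFunOn_apply hbsa (Fin.last b)
  have hs1 : IsSemialgebraicFunOn ℚ (KZlog.band G (fun _ => (1:ℝ)) (fun _ => 1))
      (fun z => z (Fin.last b) - 1) :=
    (IsSemialgebraicFunOn.sub_holds hsI (isSemialgebraicFunOn_ratCast hbsa 1)).congr fun z _ => by simp
  have hs0 : ∀ z ∈ KZlog.band G (fun _ => (1:ℝ)) (fun _ => 1), z (Fin.last b) ≠ 0 := fun z hz => by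
    have h1 : (1:ℝ) ≤ z (Fin.last b) := hz.2.1
    exact (by linarith : (0:ℝ) < z (Fin.last b)).ne'
  have hRsa : IsSemialgebraicFunOn ℚ (KZlog.band G (fun _ => (1:ℝ)) (fun _ => 1))
      (fun z => q (Fin.init z) * ((z (Fin.last b) - 1) ^ m / z (Fin.last b))) :=
    IsSemialgebraicFunOn.mul_holds hqI
      (IsSemialgebraicFunOn.div (isSemialgebraicFunOn_pow' hbsa hs1 m) hsI hs0)
  have h0 : volume (KZlog.band G (fun _ => (1:ℝ)) (fun _ => 1)) = 0 := by
    refine measure_mono_null (fun z hz => ?_)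
      (Measure.pi_hyperplane (fun _ : Fin (b + 1) => (volume : Measure ℝ)) (Fin.last b) (1:ℝ))
    show z (Fin.last b) = 1
    exact le_antisymm hz.2.2 hz.2.1
  have hRint : IntegrableOn (fun z => q (Fin.init z) * ((z (Fin.last b) - 1) ^ m / z (Fin.last b)))
      (KZlog.band G (fun _ => (1:ℝ)) (fun _ => 1)) := by
    rw [IntegrableOn, Measure.restrict_eq_zero.mpr h0]
    exact integrable_zero_measure
  exact ⟨⟨_, _, hbsa, hRsa, hRint⟩, rfl, rfl⟩

end CylLog
end RegularisedLogLayer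
end Summit.KontsevichZagierPeriods.RootDecompRelativeModAbsolute.Rung30571
end
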